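import Mathlib
import HarnessLib
import Literature.Computability.AlgebraicComplexity.PatternExpressions
import Summits.ValiantsHypothesis.ValiantsHypothesis.Theorems.MonotoneRestorationOrbitCompressionQPFormulaSubstitution
import Summits.ValiantsHypothesis.ValiantsHypothesis.Theorems.MonotoneRestorationOrbitCompressionQPNarrowEsymmGeneric

/-!
# Route MonotoneRestoration — aside `OrbitCompressionQP` (stmt-ValiantsHypothesis-18332), line
# `expression_compression`: the ONE-ROW STRATUM in elementary-symmetric coordinates
# (`R1` of the repair census modulo exactly Bläser–Jindal 2019, Thm 4)

The one-row stratum of `stub_narrowExpressionCompression` consists of the matrix-symmetric families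
`f_n = Σ_i g_n(row i)` with `g_n ∈ ℂ[x_1, …, x_n]` symmetric.  By the fundamental theorem
(`MvPolynomial.esymmAlgHom_surjective`) `g_n = P_n(e_1, …, e_n)` for a unique `P_n`, the SYMMETRIC CORE of
`g_n`; Bläser–Jindal (ITCS 2019, Thm 4: `L(P) ≤ Õ(d² L(P_Sym) + d² n²)`, `deg P ≤ deg P_Sym`) says the core of a
`VP` family is `VP`.  This file proves the stratum from the core:

* `exists_esymm_subst` (value level, any labels): from pattern expressions whose values are the power sums
  `Σ_i w_i^b` (`b ≤ D`) of a family of values `w_i(ρ, γ)`, expressions of length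
  `≤ (2D+4)^{log₂ D + 1} (λ + D + 4)` whose values are `e_j(w)` (`j ≤ D`) — Newton's identities as a balanced
  product of `D` matrices of dimension `D + 1` (`NarrowClosure.exists_matrixProd`,
  `NarrowClosure.prod_newton_col_zero`, `NarrowClosure.newton_esymm_aeval`, all landed), now with OPEN labels;
* `exists_rowEsymm` — the substituends `e_j(row ρ 0)`, `j ≤ D`, as `(1,1)`-label expressions;
* ★ `narrowQP_rowEsymmSubst` — `Σ_i Q_n(e_1(row i), …, e_{m(n)}(row i))` is narrow of quasi-polynomial length
  for every `VQP` family `Q` (substitution principle `FormulaSubstitution.exists_narrow_subst_of_isVQPFamily`);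
* ★ `narrowQP_oneRow_of_symmetricCore` — `Σ_i g_n(row i)` is narrow of quasi-polynomial length whenever the
  symmetric cores `P_n` (`P_n(e_1, …, e_n) = g_n`) form a `VQP` family.  What remains of `R1` for `g ∈ VP` is
  precisely the typing of Bläser–Jindal's Theorem 4 (a named fact; not done here).

Helper file (`--supports stmt-ValiantsHypothesis-18332`); def-free; nothing here is a named fact; no registered
stub is closed; VP ≠ VNP is not moved.
-/

noncomputable section

open MvPolynomial

-- `Summit.ValiantsHypothesis.ValiantsHypothesis.…` is the tree's single-conjunct layout (Sub = Summit).
set_option linter.dupNamespace false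

namespace Summit.ValiantsHypothesis.ValiantsHypothesis.Theorems

namespace FormulaSubstitution

open Literature.Computability.AlgebraicComplexity

/-! ### Elementary symmetric polynomials of a family of values, at the value level -/

section SingleLevel

variable {k l : ℕ} {ι : Type} [Fintype ι] [DecidableEq ι]

/-- **Newton substituends with open labels.**  If `pw b` (`b ≤ D`) are pattern expressions of length `≤ λ`
whose value at `(ρ, γ)` is the power sum `Σ_i (w i ρ γ)^b` of a family of values, then for every `j ≤ D`
there is an expression of length `≤ (2(D+1)+2)^{log₂ D + 1} (λ + 2 + (D+1) + 1)` whose value at `(ρ, γ)` is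
`e_j(w · ρ γ)`: column `0` of the balanced product of the `D` Newton matrices. [folklore] -/
theorem exists_esymm_subst (n D lam : ℕ)
    (w : ι → (Fin k → Fin n) → (Fin l → Fin n) → MvPolynomial (Fin n × Fin n) ℂ)
    (pw : ℕ → PatternExpr ℂ k l)
    (hpw : ∀ b : ℕ, b ≤ D → (pw b).length ≤ lam ∧
      ∀ (ρ : Fin k → Fin n) (γ : Fin l → Fin n), (pw b).value n ρ γ = ∑ i, (w i ρ γ) ^ b) :
    ∃ E : ℕ → PatternExpr ℂ k l, ∀ j : ℕ, j ≤ D →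
      (E j).length ≤ (2 * (D + 1) + 2) ^ (Nat.log 2 D + 1) * (lam + 2 + (D + 1) + 1) ∧
      ∀ (ρ : Fin k → Fin n) (γ : Fin l → Fin n),
        (E j).value n ρ γ = aeval (fun i => w i ρ γ) (esymm ι ℂ j) := by
  classical
  -- the Newton matrices of expressions (as in `NarrowClosure.narrowQP_esymm_of_powerSums`)
  set Mx : ℕ → Matrix (Fin (D + 1)) (Fin (D + 1)) (PatternExpr ℂ k l) := fun u => Matrix.of fun i j =>
    if (i : ℕ) = u + 1 then
      (if (j : ℕ) < u + 1 then
        PatternExpr.mul (PatternExpr.const ((((u + 1 : ℕ) : ℂ))⁻¹ * (-1) ^ (u + 2) * (-1) ^ (j : ℕ)))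
          (pw (u + 1 - j))
       else PatternExpr.const 0)
    else (if i = j then PatternExpr.const 1 else PatternExpr.const 0) with hMx
  have hMx_len : ∀ u, u < D → ∀ i j, (Mx u i j).length ≤ lam + 2 := by
    intro u hu i j
    simp only [hMx, Matrix.of_apply]
    split_ifs with h1 h2
    · simp only [PatternExpr.length]
      have := (hpw (u + 1 - (j : ℕ)) (by omega)).1
      omega
    all_goals simp [PatternExpr.length]
  have hMx_val : ∀ u, u < D → ∀ (ρ : Fin k → Fin n) (γ : Fin l → Fin n),
      ((Mx u).map fun e => e.value n ρ γ) =
      Matrix.of fun i j : Fin (D + 1) =>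
        if (i : ℕ) = u + 1 then
          (if (j : ℕ) < u + 1 then
            algebraMap ℂ _ ((((u + 1 : ℕ) : ℂ))⁻¹ * (-1) ^ (u + 2) * (-1) ^ (j : ℕ)) *
              ∑ i', (w i' ρ γ) ^ (u + 1 - j)
           else 0)
        else (if i = j then 1 else 0) := by
    intro u hu ρ γ
    ext i j
    simp only [hMx, Matrix.map_apply, Matrix.of_apply]
    split_ifs with h1 h2
    · rw [PatternExpr.value_mul, PatternExpr.value_const, (hpw (u + 1 - (j : ℕ)) (by omega)).2 ρ γ,
        MvPolynomial.algebraMap_eq]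
    all_goals simp
  have hLlen : ((List.range D).reverse.map Mx).length ≤ 2 ^ (Nat.log 2 D + 1) := by
    rw [List.length_map, List.length_reverse, List.length_range]
    exact (Nat.lt_pow_succ_log_self Nat.one_lt_two D).le
  have hLlam : ∀ M ∈ (List.range D).reverse.map Mx, ∀ i j, (M i j).length ≤ lam + 2 := by
    intro M hM i j
    rw [List.mem_map] at hM
    obtain ⟨u, hu, rfl⟩ := hM
    exact hMx_len u (by simpa using hu) i j
  obtain ⟨P, hPlen, hPval⟩ :=
    NarrowClosure.exists_matrixProd (lam + 2) (Nat.log 2 D + 1) ((List.range D).reverse.map Mx) hLlen hLlam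
  refine ⟨fun j => if h : j ≤ D then P ⟨j, Nat.lt_succ_of_le h⟩ 0 else PatternExpr.const 0,
    fun j hj => ?_⟩
  simp only [dif_pos hj]
  refine ⟨hPlen _ _, fun ρ γ => ?_⟩
  have h := congrFun (congrFun (hPval n ρ γ) ⟨j, Nat.lt_succ_of_le hj⟩) 0
  rw [Matrix.map_apply] at h
  rw [h, List.map_map]
  simp only [Function.comp_def]
  rw [List.map_congr_left (fun u hu => hMx_val u (by simpa using hu) ρ γ)]
  -- Newton's identities for the evaluation `w · ρ γ`
  set E : ℕ → MvPolynomial (Fin n × Fin n) ℂ := fun j => aeval (fun i => w i ρ γ) (esymm ι ℂ j) with hE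
  set Ps : ℕ → MvPolynomial (Fin n × Fin n) ℂ := fun b => ∑ i, (w i ρ γ) ^ b with hPs
  have hE0 : E 0 = 1 := by simp [hE, esymm_zero]
  have hNewton : ∀ j : ℕ, 0 < j → j ≤ D →
      E j = algebraMap ℂ _ ((j : ℂ)⁻¹ * (-1) ^ (j + 1)) *
        ∑ b ∈ Finset.range j, (-1) ^ b * E b * Ps (j - b) :=
    fun j hj _ => NarrowClosure.newton_esymm_aeval (fun i => w i ρ γ) j hj
  have hcol := NarrowClosure.prod_newton_col_zero D E Ps hE0 hNewton D le_rfl ⟨j, Nat.lt_succ_of_le hj⟩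
  rw [if_pos hj] at hcol
  exact hcol

/-- **Row elementary symmetric polynomials as substituends**: with one row and one column label, for
every `j ≤ D` an expression of length `≤ (2(D+1)+2)^{log₂ D + 1} (3D + 8)` whose value at `(ρ, γ)` is
`e_j(x_{ρ 0, 0}, …, x_{ρ 0, n-1})` (power sums `sumCol (edge)^b`, then `exists_esymm_subst`). [folklore] -/
theorem exists_rowEsymm (n D : ℕ) :
    ∃ E : ℕ → PatternExpr ℂ 1 1, ∀ j : ℕ, j ≤ D →
      (E j).length ≤ (2 * (D + 1) + 2) ^ (Nat.log 2 D + 1) * ((2 * D + 2) + 2 + (D + 1) + 1) ∧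
      ∀ (ρ γ : Fin 1 → Fin n),
        (E j).value n ρ γ =
          aeval (fun v : Fin n => (X (ρ 0, v) : MvPolynomial (Fin n × Fin n) ℂ)) (esymm (Fin n) ℂ j) := by
  classical
  choose pw hpwl hpwv using fun b : ℕ => exists_rowPowerSum (F := ℂ) b
  exact exists_esymm_subst n D (2 * D + 2) (fun v ρ _ => X (ρ 0, v)) pw
    fun b hb => ⟨by rw [hpwl]; omega, fun ρ γ => hpwv b n ρ γ⟩

/-- **All-entries elementary symmetric polynomials as substituends**: for every `j ≤ D` an expression of
length `≤ (2(D+1)+2)^{log₂ D + 1} (3D + 9)` whose value is `e_j` of the `n²` entries. [folklore] -/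
theorem exists_fullEsymm (n D : ℕ) :
    ∃ E : ℕ → PatternExpr ℂ 1 1, ∀ j : ℕ, j ≤ D →
      (E j).length ≤ (2 * (D + 1) + 2) ^ (Nat.log 2 D + 1) * ((2 * D + 3) + 2 + (D + 1) + 1) ∧
      ∀ (ρ γ : Fin 1 → Fin n),
        (E j).value n ρ γ =
          aeval (fun uv : Fin n × Fin n => (X uv : MvPolynomial (Fin n × Fin n) ℂ))
            (esymm (Fin n × Fin n) ℂ j) := by
  classical
  choose pw hpwl hpwv using fun b : ℕ => exists_fullPowerSum (F := ℂ) b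
  refine exists_esymm_subst n D (2 * D + 3) (fun uv _ _ => X uv) pw
    fun b hb => ⟨by rw [hpwl]; omega, fun ρ γ => ?_⟩
  rw [hpwv b n ρ γ, ← Finset.sum_product' (f := fun u v => (X (u, v) : MvPolynomial (Fin n × Fin n) ℂ) ^ b),
    Finset.univ_product_univ]

end SingleLevel

/-! ### The one-row stratum -/

section Strata

/-- Arithmetic: the length of the Newton substituends is quasi-polynomial along a p-bounded `D`. [folklore] -/
theorem esymm_subst_length_qp (a : ℕ) : ∃ c : ℕ, ∀ n D : ℕ, D ≤ n ^ a + a →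
    (2 * (D + 1) + 2) ^ (Nat.log 2 D + 1) * ((2 * D + 3) + 2 + (D + 1) + 1) ≤
      2 ^ ((Nat.log 2 n + c) ^ c) := by
  obtain ⟨c₀, hc₀⟩ := NarrowClosure.qp_combine (a + 1) 0
  obtain ⟨c, hc⟩ := NarrowClosure.matrixProduct_length_qp c₀
  refine ⟨c, fun n D hD => ?_⟩
  have hX : n ^ a + a ≤ 2 ^ ((Nat.log 2 n + (a + 1)) ^ (a + 1)) := CompressionFloors.pbounded_le_qp n a
  have h1 := hc₀ (Nat.log 2 n) (n ^ a + a) 1 hX (by simp)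
  have hB : 2 * D + 5 ≤ 2 ^ ((Nat.log 2 n + c₀) ^ c₀) := by omega
  have h := hc (Nat.log 2 n) (D + 1) D (2 * D + 5) (by omega) (by omega) hB
  have heq : (2 * D + 3) + 2 + (D + 1) + 1 = (2 * D + 5) + (D + 1) + 1 := by ring
  rw [heq]
  omega

/-- ★ **The one-row stratum in elementary-symmetric coordinates is narrow of quasi-polynomial length.**  For
every `VQP` family `Q_n ∈ ℂ[y_1, …, y_{m(n)}]`, the matrix-symmetric family
`f_n = Σ_i Q_n(e_1(row i), …, e_{m(n)}(row i))` (`e_j(row i)` the elementary symmetric polynomial of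
`x_{i,0}, …, x_{i,n-1}`) satisfies the conclusion of `stub_narrowExpressionCompression` (with `k = l = 1`).
[cite: BurgisserClausenShokrollahi1997, Thm. (21.33)] -/
theorem narrowQP_rowEsymmSubst {m : ℕ → ℕ} (Q : (n : ℕ) → MvPolynomial (Fin (m n)) ℂ)
    (hQ : IsVQPFamily Q) :
    ∃ c : ℕ, ∀ n : ℕ, 1 ≤ n → ∃ (k l : ℕ) (e : PatternExpr ℂ k l),
      n ^ (k + l) ≤ 2 ^ ((Nat.log 2 n + c) ^ c) ∧ e.length ≤ 2 ^ ((Nat.log 2 n + c) ^ c) ∧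
      e.close n = ∑ i : Fin n, aeval (fun j : Fin (m n) =>
        aeval (fun v : Fin n => (X (i, v) : MvPolynomial (Fin n × Fin n) ℂ)) (esymm (Fin n) ℂ (j.val + 1)))
          (Q n) := by
  classical
  choose E hE using fun n : ℕ => exists_rowEsymm n (m n)
  obtain ⟨a, ha⟩ := hQ.1.1
  have hθ : ∃ c : ℕ, ∀ n : ℕ, 1 ≤ n → ∀ i : Fin (m n),
      (E n (i.val + 1)).length ≤ 2 ^ ((Nat.log 2 n + c) ^ c) := by
    obtain ⟨c, hc⟩ := esymm_subst_length_qp a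
    refine ⟨c, fun n _ i => ?_⟩
    have hm : m n ≤ n ^ a + a := by simpa using ha n
    exact ((hE n (i.val + 1) (by omega)).1.trans (Nat.mul_le_mul_left _ (by omega))).trans (hc n (m n) hm)
  obtain ⟨c₁, hc₁⟩ := exists_narrow_subst_of_isVQPFamily Q hQ (k := fun _ => 1) (l := fun _ => 1)
    (fun n i => E n (i.val + 1)) hθ
  obtain ⟨c₂, hc₂⟩ := NarrowClosure.qp_combine c₁ 0
  refine ⟨max c₂ 3, fun n hn => ?_⟩
  obtain ⟨e, hl, hv⟩ := hc₁ n hn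
  set g : Fin n → MvPolynomial (Fin n × Fin n) ℂ := fun i => aeval (fun j : Fin (m n) =>
    aeval (fun v : Fin n => (X (i, v) : MvPolynomial (Fin n × Fin n) ℂ)) (esymm (Fin n) ℂ (j.val + 1)))
      (Q n) with hg
  have hval : ∀ (ρ γ : Fin 1 → Fin n), (PatternExpr.sumRow 0 e).value n ρ γ = ∑ i : Fin n, g i := by
    intro ρ γ
    simp only [PatternExpr.value_sumRow, hv]
    refine Finset.sum_congr rfl fun i _ => ?_
    have hfun : (fun j : Fin (m n) => (E n (j.val + 1)).value n (Function.update ρ 0 i) γ) =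
        fun j : Fin (m n) => aeval (fun v : Fin n => (X (i, v) : MvPolynomial (Fin n × Fin n) ℂ))
          (esymm (Fin n) ℂ (j.val + 1)) := by
      funext j
      rw [(hE n (j.val + 1) (by have := j.isLt; omega)).2, Function.update_self]
    rw [hfun]
  obtain ⟨e', hl', hc'⟩ := exists_close_eq_of_value_const hn (PatternExpr.sumRow 0 e) _ hval
  refine ⟨1, 1, e', ?_, ?_, hc'⟩
  · calc n ^ (1 + 1) ≤ n ^ 2 + 2 := by norm_num
      _ ≤ 2 ^ ((Nat.log 2 n + 3) ^ 3) := CompressionFloors.pbounded_le_qp n 2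
      _ ≤ 2 ^ ((Nat.log 2 n + max c₂ 3) ^ max c₂ 3) :=
          Nat.pow_le_pow_right (by norm_num) (CompressionFloors.polylog_mono (le_max_right _ _))
  · have h := hc₂ (Nat.log 2 n) e.length 0 hl (by simp)
    calc e'.length = e.length + 3 := by rw [hl']; simp [PatternExpr.length]
      _ ≤ (e.length + 2) * (0 + 2) := by omega
      _ ≤ 2 ^ ((Nat.log 2 n + c₂) ^ c₂) := h
      _ ≤ 2 ^ ((Nat.log 2 n + max c₂ 3) ^ max c₂ 3) :=
          Nat.pow_le_pow_right (by norm_num) (CompressionFloors.polylog_mono (le_max_left _ _))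

/-- ★ **The one-row stratum from the symmetric core.**  Let `g_n ∈ ℂ[x_0, …, x_{n-1}]` and let
`P_n ∈ ℂ[y_0, …, y_{n-1}]` be its symmetric core, `P_n(e_1, …, e_n) = g_n` (it exists iff `g_n` is
symmetric, `MvPolynomial.esymmAlgHom_surjective`, and is then unique).  If `(P_n)` is a `VQP` family then
`f_n = Σ_i g_n(x_{i,0}, …, x_{i,n-1})` is narrow of quasi-polynomial length.  For `g ∈ VP` symmetric the
hypothesis is Bläser–Jindal 2019, Thm 4 (`L(P) ≤ Õ(d² L(P_Sym) + d² n²)`, `deg P ≤ deg P_Sym`) — the one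
remaining input of the census item `R1`, to be typed as a named fact.
[cite: BurgisserClausenShokrollahi1997, Thm. (21.33)] -/
theorem narrowQP_oneRow_of_symmetricCore (g P : (n : ℕ) → MvPolynomial (Fin n) ℂ)
    (hP : ∀ n, aeval (fun j : Fin n => esymm (Fin n) ℂ (j.val + 1)) (P n) = g n)
    (hPq : IsVQPFamily P) :
    ∃ c : ℕ, ∀ n : ℕ, 1 ≤ n → ∃ (k l : ℕ) (e : PatternExpr ℂ k l),
      n ^ (k + l) ≤ 2 ^ ((Nat.log 2 n + c) ^ c) ∧ e.length ≤ 2 ^ ((Nat.log 2 n + c) ^ c) ∧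
      e.close n = ∑ i : Fin n,
        aeval (fun v : Fin n => (X (i, v) : MvPolynomial (Fin n × Fin n) ℂ)) (g n) := by
  obtain ⟨c, hc⟩ := narrowQP_rowEsymmSubst (m := fun n => n) P hPq
  refine ⟨c, fun n hn => ?_⟩
  obtain ⟨k, l, e, hkl, hlen, hclose⟩ := hc n hn
  refine ⟨k, l, e, hkl, hlen, ?_⟩
  rw [hclose]
  refine Finset.sum_congr rfl fun i _ => ?_
  rw [← hP n, ← AlgHom.comp_apply, comp_aeval]

/-- **Symmetric cores exist**: a symmetric `g ∈ ℂ[x_0, …, x_{n-1}]` is `P(e_1, …, e_n)` for some `P`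
(fundamental theorem of symmetric polynomials, Mathlib's `MvPolynomial.esymmAlgHom_surjective`). [folklore] -/
theorem exists_symmetricCore {n : ℕ} (g : MvPolynomial (Fin n) ℂ) (hg : g.IsSymmetric) :
    ∃ P : MvPolynomial (Fin n) ℂ, aeval (fun j : Fin n => esymm (Fin n) ℂ (j.val + 1)) P = g := by
  obtain ⟨P, hP⟩ := esymmAlgHom_surjective ℂ (σ := Fin n) (n := n) (by simp) ⟨g, hg⟩
  refine ⟨P, ?_⟩
  have := congrArg Subtype.val hP
  rwa [esymmAlgHom_apply] at this

end Strata

end FormulaSubstitution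

end Summit.ValiantsHypothesis.ValiantsHypothesis.Theorems

end
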